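import Literature.Geometry.Lorentzian.CoordConstraintBridge
import Literature.Geometry.Lorentzian.AFEndAnnulusPatch
import Literature.Geometry.Lorentzian.AFEndBreathingFamily
import HarnessLib

/-!
# Parametric annular gluing, read in the chart of the end: the coordinate constraint bridge

Topic `Literature/Geometry/Lorentzian`. Everything here is PROVED; no definition, no statement of
`Prop` type is introduced.

Bookkeeping for the assembly of the named fact `ChruscielDelay_parametricAnnulusGluing`
(`ParametricAnnulusGluing.lean`; Chruściel–Delay 2003, Thm. 5.9 / Prop. 5.10 / Cor. 5.11 and §8.6)
which isolates its analytic core as a statement about COORDINATE fields on an annulus of `E3`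
(`ParametricAnnulusGluingReduction.lean`). Let `e : AFEnd X` be an end of the `3`-manifold `X`
with inverse chart `Φ = e.dataChart : {R < ‖z‖} → X` and coordinate function `e.coord`, and let
`(hCoeff e D, kCoeff e D)` be the chart components of a datum `D` (`AsymptoticFlatness.lean`).

* `AFEnd.comap_dataChart_metric_val`, `comap_dataChart_k` — the sections of `Φ^* D`
  (`InitialDataSet.comap`) on the exterior region ARE the chart components;
* `AFEnd.isVacuumAt_dataChart_iff_coord` — **the vacuum constraint equations of `D` at `Φ z` are
  the coordinate constraint equations `hamAt = 0`, `momFn = 0` of the chart components at `z`**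
  (naturality `isVacuumAt_comap_iff` + the chart bridge `OpensChart.hamiltonianConstraintFn_eq_hamAt`,
  `momentumConstraintFn_eq_momFn` of `CoordConstraintBridge.lean`); `coordVacuum_of_isVacuum`,
  `isVacuumAt_of_coordVacuum` — the two directions used by the reduction;
* `AFEnd.hCoeff_pos'`, `contDiffOn_hCoeff_family`, `contDiffOn_kCoeff_family` — the chart
  components of a smooth one-parameter family of data are positive definite and jointly `C^∞` on
  `ℝ¹ × {R < ‖z‖}`;
* `AFEnd.hCoeff_eq_of_h_inner_eq_outerField`, `kCoeff_eq_of_k_eq_outerField` — reading an outer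
  field `coord^* H` back through `Φ`: its chart components are `H`;
* `AFEnd.contMDiffAt_outerField_family_of_contDiffAt` — joint smoothness of the outer fields of a
  family of coordinate fields which is jointly `C^∞` only NEAR the relevant point (the local form
  of `contMDiffAt_outerField_family`).

## References

* P. T. Chruściel, E. Delay, Mém. Soc. Math. Fr. 94 (2003), Thm. 5.9, Prop. 5.10, Cor. 5.11, §8.6.
  [ChruscielDelay2003]
* R. Bartnik, J. Isenberg, *The constraint equations* (2004), §2, (2.1)–(2.2). [BartnikIsenberg2004]
* R. Bartnik, *The mass of an asymptotically flat manifold*, CPAM 39 (1986), §1, (1.3). [Bartnik1986]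
-/

noncomputable section

set_option maxSynthPendingDepth 3

open Bundle Set Function Filter TopologicalSpace Manifold Module Metric
open scoped Manifold ContDiff Topology

namespace Literature.Geometry.Lorentzian

namespace AFEnd

variable {X : Type} [TopologicalSpace X] [ChartedSpace E3 X] [IsManifold (𝓡 3) ∞ X]
  (e : AFEnd X) (D : InitialDataSet (𝓡 3) X)

/-! ### The sections of `Φ^* D` are the chart components -/

/-- The metric of `Φ^* D` on the exterior region is represented by the chart components `h_ij`:
`(Φ^* h)_u = hCoeff e D u`. [cite: Bartnik1986, (1.3)] -/
theorem comap_dataChart_metric_val (u : exteriorRegion e.R) :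
    (D.comap e.dataChart e.contMDiff_dataChart_succ e.injective_mfderiv_dataChart).metric.val u =
      hCoeff e D u := by
  ext v w
  exact (e.hCoeff_apply_eq_dataChart D u v w).symm

/-- The tensor `k` of `Φ^* D` on the exterior region is represented by the chart components `k_ij`:
`(Φ^* k)_u = kCoeff e D u`. [cite: ChristodoulouKlainerman1993, (1.0.9)] -/
theorem comap_dataChart_k (u : exteriorRegion e.R) :
    (D.comap e.dataChart e.contMDiff_dataChart_succ e.injective_mfderiv_dataChart).k u =
      kCoeff e D u := by
  ext v w
  exact (e.kCoeff_apply_eq_dataChart D u v w).symm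

/-! ### The vacuum constraints of `D` on the end are the coordinate constraints of `(h_ij, k_ij)` -/

/-- **The constraint equations on the end, in the chart**: for `u` in the exterior region, `D`
satisfies the vacuum constraint equations at `Φ u` iff its chart components satisfy the coordinate
constraint equations `hamAt (h_ij) (k_ij) u = 0`, `momFn b (h_ij) (k_ij) u = 0` (any basis `b`).
Bartnik–Isenberg 2004, (2.1)–(2.2), via the naturality of the constraint map under the local
diffeomorphism `Φ` and the chart bridge on the open set `{R < ‖z‖}`.
[cite: BartnikIsenberg2004, (2.1)–(2.2)] -/
theorem isVacuumAt_dataChart_iff_coord [D.metric.HasLeviCivita] {ι : Type*} [Fintype ι]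
    (b : Basis ι ℝ E3) (u : exteriorRegion e.R) :
    (D.hamiltonianConstraintFn (e.dataChart u) = 0 ∧ D.momentumConstraintFn (e.dataChart u) = 0) ↔
      (MetricCoord.hamAt (hCoeff e D) (kCoeff e D) u = 0 ∧
        ∀ Z : E3, MetricCoord.momFn b (hCoeff e D) (kCoeff e D) u Z = 0) := by
  haveI : (D.comap e.dataChart e.contMDiff_dataChart_succ
      e.injective_mfderiv_dataChart).metric.HasLeviCivita :=
    PseudoRiemannianMetric.hasLeviCivita _
  rw [← InitialDataSet.isVacuumAt_comap_iff D e.contMDiff_dataChart_succ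
    e.injective_mfderiv_dataChart u,
    OpensChart.hamiltonianConstraintFn_eq_hamAt (e.comap_dataChart_metric_val D)
      (e.comap_dataChart_k D) u]
  refine and_congr Iff.rfl ⟨fun h Z ↦ ?_, fun h ↦ LinearMap.ext fun Z ↦ ?_⟩
  · rw [← OpensChart.momentumConstraintFn_eq_momFn (e.comap_dataChart_metric_val D)
      (e.comap_dataChart_k D) b u Z, h, LinearMap.zero_apply]
  · rw [OpensChart.momentumConstraintFn_eq_momFn (e.comap_dataChart_metric_val D)
      (e.comap_dataChart_k D) b u Z, h Z, LinearMap.zero_apply]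

/-- **Vacuum data have coordinate-vacuum chart components on the exterior region.**
[cite: BartnikIsenberg2004, (2.1)–(2.2)] -/
theorem coordVacuum_of_isVacuum (hvac : ∀ [D.metric.HasLeviCivita], D.IsVacuumConstraintSolution)
    {ι : Type*} [Fintype ι] (b : Basis ι ℝ E3) {z : E3} (hz : e.R < ‖z‖) :
    MetricCoord.hamAt (hCoeff e D) (kCoeff e D) z = 0 ∧
      ∀ Z : E3, MetricCoord.momFn b (hCoeff e D) (kCoeff e D) z Z = 0 := by
  haveI := D.metric.hasLeviCivita
  exact (e.isVacuumAt_dataChart_iff_coord D b ⟨z, hz⟩).1 (hvac _)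

/-- **Coordinate-vacuum chart components give vacuum data on the end**: if the chart components of
`D` satisfy the coordinate constraint equations at `coord x` (`x` in the end), then `D` satisfies
the vacuum constraint equations at `x`. [cite: BartnikIsenberg2004, (2.1)–(2.2)] -/
theorem isVacuumAt_of_coordVacuum [D.metric.HasLeviCivita] {ι : Type*} [Fintype ι]
    (b : Basis ι ℝ E3) {x : X} (hx : x ∈ e.U)
    (h : MetricCoord.hamAt (hCoeff e D) (kCoeff e D) (e.coord x) = 0 ∧
      ∀ Z : E3, MetricCoord.momFn b (hCoeff e D) (kCoeff e D) (e.coord x) Z = 0) :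
    D.hamiltonianConstraintFn x = 0 ∧ D.momentumConstraintFn x = 0 := by
  have h' := (e.isVacuumAt_dataChart_iff_coord D b ⟨e.coord x, e.lt_norm_coord hx⟩).2 h
  rwa [e.dataChart_coord hx] at h'

/-! ### Chart components of a smooth family: positivity and joint smoothness -/

/-- **The chart components of the metric are positive definite** on the exterior region (`dΦ` is
injective). [cite: Bartnik1986, (1.3)] -/
theorem hCoeff_pos' {z : E3} (hz : e.R < ‖z‖) (v : E3) (hv : v ≠ 0) : 0 < hCoeff e D z v v := by
  have h := e.hCoeff_apply_eq_dataChart D ⟨z, hz⟩ v v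
  rw [show ((⟨z, hz⟩ : exteriorRegion e.R) : E3) = z from rfl] at h
  rw [h]
  exact D.h.pos _ _ fun h0 ↦ hv (e.injective_mfderiv_dataChart ⟨z, hz⟩
    (h0.trans (map_zero _).symm))

/-- **The chart components `h_ij` of a smooth one-parameter family of data are jointly `C^∞`** on
`ℝ¹ × {R < ‖z‖}`. [cite: Bartnik1986, (1.3)] -/
theorem contDiffOn_hCoeff_family {F : EuclideanSpace ℝ (Fin 1) → InitialDataSet (𝓡 3) X}
    (hF : InitialDataSet.IsSmoothDataFamily 1 F) :
    ContDiffOn ℝ ∞ (fun p : EuclideanSpace ℝ (Fin 1) × E3 ↦ hCoeff e (F p.1) p.2)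
      ((univ : Set (EuclideanSpace ℝ (Fin 1))) ×ˢ (exteriorRegion e.R : Set E3)) :=
  fun p hp ↦ (contDiffAt_hCoeff_family (e := e) hF.1 p.1 hp.2).contDiffWithinAt

/-- **The chart components `k_ij` of a smooth one-parameter family of data are jointly `C^∞`** on
`ℝ¹ × {R < ‖z‖}`. [cite: ChristodoulouKlainerman1993, (1.0.9)] -/
theorem contDiffOn_kCoeff_family {F : EuclideanSpace ℝ (Fin 1) → InitialDataSet (𝓡 3) X}
    (hF : InitialDataSet.IsSmoothDataFamily 1 F) :
    ContDiffOn ℝ ∞ (fun p : EuclideanSpace ℝ (Fin 1) × E3 ↦ kCoeff e (F p.1) p.2)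
      ((univ : Set (EuclideanSpace ℝ (Fin 1))) ×ˢ (exteriorRegion e.R : Set E3)) :=
  fun p hp ↦ (contDiffAt_kCoeff_family (e := e) hF.2 p.1 hp.2).contDiffWithinAt

/-! ### Reading outer fields back through `Φ` -/

/-- **The chart components of an outer metric are the coordinate field**: if the metric of `D₁` at
`Φ z` is the outer field `coord^* H` there (`‖z‖ > R`), then `hCoeff e D₁ z = H z`
(`dcoord ∘ dΦ = id`). [cite: Bartnik1986, (1.3)] -/
theorem hCoeff_eq_of_h_inner_eq_outerField (D₁ : InitialDataSet (𝓡 3) X)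
    {H : E3 → E3 →L[ℝ] E3 →L[ℝ] ℝ} {z : E3} (hz : e.R < ‖z‖)
    (h : D₁.h.inner (e.dataChartExt z) = outerField e H (e.dataChartExt z)) :
    hCoeff e D₁ z = H z := by
  rw [hCoeff_eq_pullbackBilin_dataChartExt D₁ hz]
  exact e.pullbackBilin_dataChartExt_apply_of_eq hz h

/-- **The chart components of an outer `k` are the coordinate field**: if `k` of `D₁` at `Φ z` is
the outer field `coord^* H` there, then `kCoeff e D₁ z = H z`. [cite: ChristodoulouKlainerman1993, (1.0.9)] -/
theorem kCoeff_eq_of_k_eq_outerField (D₁ : InitialDataSet (𝓡 3) X)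
    {H : E3 → E3 →L[ℝ] E3 →L[ℝ] ℝ} {z : E3} (hz : e.R < ‖z‖)
    (h : D₁.k (e.dataChartExt z) = outerField e H (e.dataChartExt z)) :
    kCoeff e D₁ z = H z := by
  rw [kCoeff_eq_pullbackBilin_dataChartExt D₁ hz]
  exact e.pullbackBilin_dataChartExt_apply_of_eq hz h

/-! ### Outer fields of locally smooth families of coordinate fields -/

/-- **Joint smoothness of the outer fields of a locally smooth family**: if the family of
coordinate fields `(c, z) ↦ H c z` (parameters in a real normed space) is jointly `C^∞` at
`(c₀, coord x₀)`, `x₀` in the end, then `(c, x) ↦ (coord^*(H c))_x` is jointly smooth at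
`(c₀, x₀)` as a map into the bundle of bilinear forms on `TX`. [cite: ONeill1983, Ch. 3, Lemma 3.35] -/
theorem contMDiffAt_outerField_family_of_contDiffAt {P : Type*} [NormedAddCommGroup P]
    [NormedSpace ℝ P] {H : P → E3 → E3 →L[ℝ] E3 →L[ℝ] ℝ} {c₀ : P} {x₀ : X} (hx₀ : x₀ ∈ e.U)
    (hH : ContDiffAt ℝ ∞ (uncurry H) (c₀, e.coord x₀)) :
    ContMDiffAt (𝓘(ℝ, P).prod (𝓡 3)) ((𝓡 3).prod 𝓘(ℝ, E3 →L[ℝ] E3 →L[ℝ] ℝ)) ∞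
      (fun q : P × X ↦ TotalSpace.mk' (E3 →L[ℝ] E3 →L[ℝ] ℝ)
        (E := fun x : X ↦ TangentSpace (𝓡 3) x →L[ℝ] TangentSpace (𝓡 3) x →L[ℝ] ℝ) q.2
        (outerField e (H q.1) q.2)) (c₀, x₀) := by
  have h1 : ContMDiffAt 𝓘(ℝ, P × E3) 𝓘(ℝ, E3 →L[ℝ] E3 →L[ℝ] ℝ) ∞ (uncurry H) (c₀, e.coord x₀) :=
    hH.contMDiffAt
  rw [modelWithCornersSelf_prod, ← chartedSpaceSelf_prod] at h1
  exact e.contMDiffAt_outerField_family (IP := 𝓘(ℝ, P)) hx₀ h1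

end AFEnd

end Literature.Geometry.Lorentzian

end
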